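import Summits.NavierStokesRegularity.NavierStokesRegularity.Theorems.FiniteTangentModuliMild.Negative.KolmogorovModesBounds

/-!
# `FiniteTangentModuliMild`: the linearised Oseen (mild) identity is load-bearing

Negative-side support for crux stmt-NavierStokesRegularity-14049 (cdisprove seat, cycle 1).  Dropping
ONLY the last conjunct of the crux's class — the linearised Oseen identity
`v(t) = e^{(t-s)Δ}v(s) - ∫ₛᵗ∫ (K[u,v] + K[v,u])` — makes the statement false
(`finiteTangentModuliMild_false_without_mild`): around the decaying Kolmogorov shear
`u = (1-t)⁻¹ sin(x₀) e₁` (`C = 1`) the dressed parasitic modes `v_k = a^{k+2} cos(x₀) e₁ + B_k(t) e₀`,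
`q_k = -B_k'(t) x₀` (`a = (1-t)⁻¹`, `B_k = -((k+2)a^{k+2} + a^{k+1})`) of the refutation of the rev-1
crux `FiniteTangentModuli` (p73226, `Theorems/SymmetryModuliCountFiniteTangentModuliRefutation.lean`,
whose construction is `private`; made public in `KolmogorovModes.lean` / `KolmogorovModesBounds.lean`,
namespace `KolmogorovCex`) already satisfy the
x-BOUNDED velocity envelope `‖v_k‖ ≤ (k+3)²/√(-t)` (no linear growth), the affine pressure envelope,
`div v_k = 0` and the linearised momentum equation, and they are plainly independent on `t < 0`
(`∑ c_k a(t)^{k+2} cos(x₀) ≡ 0` forces `c = 0`).  So the x-bounded velocity envelope alone does not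
exclude the parasitic family (the affine PRESSURE envelope lets `q = -b'·x` in); any proof of the crux
must use the mild identity.  Companion (`TrivialSectors.lean`): WITH the identity the whole
`x₁`-independent sector about this drift is `{0}`.

## References

* G. Koch, N. Nadirashvili, G. Seregin, V. Šverák, Acta Math. 203 (2009), §1 p. 3 (parasitic
  solutions `b(t)`, `-b'(t)·x`; the mild formulation (1.7)–(1.9)). [KNSS2009]
* G. Seregin, *Lecture Notes on Regularity Theory for the Navier–Stokes Equations*, World Scientific
  2014, Def. 6.3 p. 109, p. 113. [Seregin2014Notes]
-/

noncomputable section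

open Set Function Filter Topology WithLp MeasureTheory InnerProductSpace
open scoped Laplacian RealInnerProductSpace ContDiff BigOperators

set_option linter.dupNamespace false

namespace Summit.NavierStokesRegularity.NavierStokesRegularity.Theorems.FiniteTangentModuliMild.Negative

open Literature.Analysis Literature.Analysis.FluidPDE Literature.Analysis.FluidPDE.StrainedShear
open Summit.NavierStokesRegularity.NavierStokesRegularity.Theses.SymmetryModuliCount

/-- Local notation for physical space `ℝ³ = EuclideanSpace ℝ (Fin 3)`. -/
local notation "ℝ³" => EuclideanSpace ℝ (Fin 3)

/-! ## The crux without the mild identity, and its refutation -/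

/-- `FiniteTangentModuliMild` with the mild-identity conjunct DROPPED (everything else verbatim). -/
def FiniteTangentModuliMildWithoutMild : Prop :=
  ∀ (C : ℝ) (u : ℝ → ℝ³ → ℝ³), ContDiffOn ℝ (⊤ : ℕ∞) (Function.uncurry u) (Set.Iio 0 ×ˢ Set.univ) →
    (∀ t < 0, VectorCalculus.IsDivFree (u t)) → HasTypeITimeDecay C u →
    (∀ t < 0, ∀ x, ‖fderiv ℝ (u t) x‖ ≤ C / (-t)) →
    ∃ N : ℕ, ∀ (v : Fin (N + 1) → ℝ → ℝ³ → ℝ³) (q : Fin (N + 1) → ℝ → ℝ³ → ℝ),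
      (∀ i, (ContDiffOn ℝ (⊤ : ℕ∞) (Function.uncurry (v i)) (Set.Iio 0 ×ˢ Set.univ) ∧
        ContDiffOn ℝ (⊤ : ℕ∞) (Function.uncurry (q i)) (Set.Iio 0 ×ˢ Set.univ) ∧
        (∃ K : ℝ, ∀ t < 0, ∀ x, ‖(v i) t x‖ ≤ K / Real.sqrt (-t) + K / (-t) ∧
          |(q i) t x| ≤ K / (-t) + K * (1 + ‖x‖) / Real.sqrt (-t) ^ 3) ∧
        (∀ t < 0, VectorCalculus.IsDivFree ((v i) t)) ∧
        (∀ t < 0, ∀ x, timeDeriv (v i) t x + convect (u t) ((v i) t) x + convect ((v i) t) (u t) x =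
          Δ ((v i) t) x - gradient ((q i) t) x))) →
      ∃ c : Fin (N + 1) → ℝ, c ≠ 0 ∧ ∀ t < 0, ∀ x, ∑ i, c i • v i t x = 0

open KolmogorovCex

/-- The parasitic modes satisfy the x-BOUNDED envelope with `K = (k+3)²` (no `(1+‖x‖)/(-t)` term
needed for the velocity). -/
theorem growth_mode_bounded (k : ℕ) : ∃ K : ℝ, ∀ t < 0, ∀ x : ℝ³,
    ‖mode k t x‖ ≤ K / Real.sqrt (-t) + K / (-t) ∧
      |modePressure k t x| ≤ K / (-t) + K * (1 + ‖x‖) / Real.sqrt (-t) ^ 3 := by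
  refine ⟨((k : ℝ) + 3) ^ 2, fun t ht x => ⟨?_, ?_⟩⟩
  · have h : 0 ≤ ((k : ℝ) + 3) ^ 2 / (-t) := by
      have : 0 < -t := by linarith
      positivity
    linarith [norm_mode_le ht k x]
  · have h : 0 ≤ ((k : ℝ) + 3) ^ 2 / (-t) := by
      have : 0 < -t := by linarith
      positivity
    linarith [abs_modePressure_le ht k x]

/-- **The mild identity is load-bearing**: without it the crux is false.  Witness: `C = 1`, the
decaying Kolmogorov shear `drift`, and for the `N` handed out the modes `mode 0, …, mode N` with
pressures `modePressure k` — x-bounded tempered classical linearised solutions, plainly independent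
(`a = (1-t)⁻¹` sweeps `(0,1)`, so `∑ c_k a^{k+2} ≡ 0` forces `c = 0`). -/
theorem finiteTangentModuliMild_false_without_mild : ¬ FiniteTangentModuliMildWithoutMild := by
  intro h
  obtain ⟨N, hN⟩ := h 1 drift contDiffOn_drift (fun t _ => isDivFree_drift t)
    hasTypeITimeDecay_drift (fun t ht x => norm_fderiv_drift_le ht x)
  obtain ⟨c, hc, hdep⟩ := hN (fun i => mode (i : ℕ)) (fun i => modePressure (i : ℕ)) fun i =>
    ⟨contDiffOn_mode _, contDiffOn_modePressure _, growth_mode_bounded _,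
      fun t _ => isDivFree_mode _ t, fun t ht x => momentum_mode ht _ x⟩
  refine hc (coeff_eq_zero_of_sum_pow_eq_zero c fun y hy => ?_)
  have ht : 1 - y⁻¹ < 0 := one_sub_inv_neg hy.1 hy.2
  have := sum_eq_zero_of_slice_constant c ⟨0, hdep _ ht⟩
  simpa [amp_one_sub_inv y] using this

end Summit.NavierStokesRegularity.NavierStokesRegularity.Theorems.FiniteTangentModuliMild.Negative

end
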